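import Summits.CriticalPhenomena.PercolationContinuityZ3.Theorems.PercNearOneGluingNoHeavyLowerTailSunflowerLeafLeafZTwo
import HarnessLib

/-!
# `NoHeavyLowerTail` (crux stmt-CriticalPhenomena-4575), abstract sunflower cubic: THE PENDANT THEOREM IS COEFFICIENTWISE IN THE
# LEAF PROBABILITY — the set-level form of T-BERN at `V = 1`

Support file (seat `prim-ineq-prove-1` gen 66; `--supports stmt-CriticalPhenomena-4575`).  No `sorry`, no named facts, no new
definitions.  Memo: run/shared/lean/prim/prim-ineq-prove-1/FINDING-RLA-prove1-g66.md §4.2.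

`Pendant.safe_union_pendant` (gen 49): for an up-set `A` not depending on `z`, `v ≠ z`, if `A`, `delMinor v A`, `conMinor v A` are safe
at `p` then so is `A ∪ {v, z open}`: `∏ μ(W_i) ≤ μ(A ∪ [vz])^(n−1)` for every petal system.  Conditioning on the leaf `z`,
`μ(W_i) = τ·μ(W_i | z open) + (1−τ)·μ(W_i | z closed)`, so `∏ μ(W_i)` is a polynomial in `τ = p_z` whose `k`-th two-coin coefficient is
`Σ_{|S|=k} ∏_{i∈S} μ(W_i | z open) ∏_{i∉S} μ(W_i | z closed)`.  **`Pendant.tcoeff_sections_le`**: EVERY such coefficient is bounded by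
the same coefficient of the comparison family {one full petal, `n−1` copies of the core} — i.e. the pendant theorem holds
COEFFICIENTWISE in `p_z` (which is strictly stronger than holding for every `p_z`).  This is `LinkedCurrency.tbern_holds` (gen 65) at cap
`V = 1`, transported to the set level exactly as `safe_union_pendant` transports `pendant_prod_le`; positivity `μ(delMinor v A) > 0` is
what T-BERN divides by.  In the leaf-leaf coefficient square (memo §4.2) these are the boundary rows `(i, 0)` and, by symmetry, `(0, j)`.
* `LinkedCurrency.tcoeff_mono` — `tcoeff` is monotone in nonnegative data;
* `Pendant.tcoeff_sections_le` — the coefficientwise pendant theorem (fixed `p`); `Pendant.tcoeff_sections_le_aSafe` — from A-safety.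
-/

noncomputable section

namespace Summit.CriticalPhenomena.PercolationContinuityZ3.Theorems.SunflowerPartition

namespace SafeCalc

open MeasureTheory Finset
open Literature.Probability.LatticeModels Literature.Probability.Percolation

namespace LinkedCurrency

variable {κ : Type*} [DecidableEq κ]

/-- `tcoeff` is monotone in nonnegative data. [this work] -/
theorem tcoeff_mono (s : Finset κ) {a c a' c' : κ → ℝ} (ha : ∀ i ∈ s, 0 ≤ a i) (hc : ∀ i ∈ s, 0 ≤ c i)
    (haa : ∀ i ∈ s, a i ≤ a' i) (hcc : ∀ i ∈ s, c i ≤ c' i) (k : ℕ) : tcoeff s a c k ≤ tcoeff s a' c' k := by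
  unfold tcoeff
  refine sum_le_sum fun S hS => ?_
  have hSs : S ⊆ s := (mem_powersetCard.1 hS).1
  refine mul_le_mul (prod_le_prod (fun i hi => ha i (hSs hi)) fun i hi => haa i (hSs hi))
    (prod_le_prod (fun i hi => hc i (sdiff_subset hi)) fun i hi => hcc i (sdiff_subset hi))
    (prod_nonneg fun i hi => hc i (sdiff_subset hi))
    (prod_nonneg fun i hi => (ha i (hSs hi)).trans (haa i (hSs hi)))

end LinkedCurrency

open RelLemmaA UnionEdge LinkedCurrency

variable {ι : Type*} [Fintype ι] [DecidableEq ι] (p : ι → unitInterval)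

namespace Pendant

/-- **THE PENDANT THEOREM, COEFFICIENTWISE IN THE LEAF PROBABILITY (fixed `p`).**  `A` an up-set not depending on `z`, `v ≠ z`,
`delMinor v A`, `conMinor v A`, `A` safe at `p`, `μ(delMinor v A) > 0`.  For every family of up-sets `W_i ⊇ A ∪ {v,z open}` meeting
pairwise inside `A ∪ {v,z open}` and every `k`:
`Σ_{|S|=k} ∏_{i∈S} μ(W_i | z open) · ∏_{i∉S} μ(W_i | z closed) ≤` the same coefficient of the comparison family
(`fullFloorA`/`fullFloorG` of `…SunflowerTBern` with `s = p_v`, `b = μ(delMinor v A)`, `β = μ(conMinor v A)`, `V = 1`).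
(From `LinkedCurrency.tbern_holds`.) [this work] -/
theorem tcoeff_sections_le {v z : ι} (hne : v ≠ z) {A : Set (Set ι)} (hd : DeterminedBy A (↑({z} : Finset ι) : Set ι)ᶜ)
    (hA : IsUpperSet A) (hA0 : Safe p (delMinor v A)) (hA1 : Safe p (conMinor v A)) (hAA : Safe p A)
    (hpos : 0 < (prodBernoulli p).real (delMinor v A))
    {n : ℕ} (W : Fin n → Set (Set ι)) (hW : ∀ i, IsUpperSet (W i)) (hWA : ∀ i, A ∪ pairOpen v z ⊆ W i)
    (hcap : ∀ i j, i ≠ j → W i ∩ W j ⊆ A ∪ pairOpen v z) (k : ℕ) :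
    tcoeff (univ : Finset (Fin n)) (fun i => (prodBernoulli p).real (secOn z (W i)))
        (fun i => (prodBernoulli p).real (secOff z (W i))) k ≤
      tcoeff (univ : Finset (Fin n)) (fullFloorA (p v : ℝ) ((prodBernoulli p).real (delMinor v A)))
        (fullFloorG (p v : ℝ) ((prodBernoulli p).real (delMinor v A)) ((prodBernoulli p).real (conMinor v A)) 1) k := by
  classical
  set s : ℝ := ((p v : unitInterval) : ℝ) with hs
  have hs0 : 0 ≤ s := (p v).2.1
  have hs1 : s ≤ 1 := (p v).2.2
  set b : ℝ := (prodBernoulli p).real (delMinor v A) with hbdef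
  set β : ℝ := (prodBernoulli p).real (conMinor v A) with hβdef
  have hbβ : b ≤ β := measureReal_mono ((delMinor_subset v hA).trans (subset_conMinor v hA))
  have hβ1 : β ≤ 1 := measureReal_le_one
  -- sections of the core
  have hA_on : secOn z A = A := secOn_eq_self_of_determinedBy hd
  have hA_off : secOff z A = A := secOff_eq_self_of_determinedBy hd
  have hC_on : secOn z (A ∪ pairOpen v z) = A ∪ {ω | v ∈ ω} := by rw [secOn_union, hA_on, secOn_pairOpen_right hne]
  have hC_off : secOff z (A ∪ pairOpen v z) = A := by rw [secOff_union, hA_off, secOff_pairOpen_right, Set.union_empty]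
  -- the three section values of each petal
  set u : Fin n → ℝ := fun i => (prodBernoulli p).real (secOff v (secOn z (W i))) with hu
  set vv : Fin n → ℝ := fun i => (prodBernoulli p).real (secOn v (secOff z (W i))) with hvv
  set m : Fin n → ℝ := fun i => (prodBernoulli p).real (secOff v (secOff z (W i))) with hm
  have hub : ∀ i, b ≤ u i := fun i => by
    have h1 : secOff v (A ∪ {ω | v ∈ ω}) ⊆ secOff v (secOn z (W i)) := hC_on ▸ secOff_mono v (secOn_mono z (hWA i))
    rw [secOff_union, secOff_setOf_mem_self, Set.union_empty] at h1
    exact measureReal_mono h1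
  have hu1 : ∀ i, u i ≤ 1 := fun i => measureReal_le_one
  have hvβ : ∀ i, β ≤ vv i := fun i => measureReal_mono (secOn_mono v (hC_off ▸ secOff_mono z (hWA i)))
  have hv1 : ∀ i, vv i ≤ 1 := fun i => measureReal_le_one
  have hmb : ∀ i, b ≤ m i := fun i => measureReal_mono (secOff_mono v (hC_off ▸ secOff_mono z (hWA i)))
  have hmu : ∀ i, m i ≤ u i := fun i => measureReal_mono (secOff_mono v (secOff_subset_secOn z (hW i)))
  have hmv : ∀ i, m i ≤ vv i := fun i => measureReal_mono (secOff_subset_secOn v (isUpperSet_secOff z (hW i)))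
  -- budgets
  have hpu : ∏ i, u i ≤ b ^ (n - 1) := by
    refine hA0 n (fun i => secOff v (secOn z (W i))) (fun i => isUpperSet_secOff v (isUpperSet_secOn z (hW i))) ?_
    intro i j hij
    rw [← secOff_inter, ← secOn_inter]
    refine (secOff_mono v (secOn_mono z (hcap i j hij))).trans ?_
    rw [hC_on, secOff_union, secOff_setOf_mem_self, Set.union_empty]; rfl
  have hpv : ∏ i, vv i ≤ β ^ (n - 1) * 1 := by
    rw [mul_one]
    refine hA1 n (fun i => secOn v (secOff z (W i))) (fun i => isUpperSet_secOn v (isUpperSet_secOff z (hW i))) ?_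
    intro i j hij
    rw [← secOn_inter, ← secOff_inter, show conMinor v A = secOn v A from rfl, ← hC_off]
    exact secOn_mono v (secOff_mono z (hcap i j hij))
  have hAval : (prodBernoulli p).real A = (1 - s) * b + s * β := by
    rw [real_eq_secOn_secOff p v A]; simp only [hbdef, hβdef, delMinor, conMinor]; ring
  have hpg : ∏ i, ((1 - s) * m i + s * vv i) ≤ ((1 - s) * b + s * β) ^ (n - 1) * 1 := by
    rw [mul_one, ← hAval]
    have h := hAA n (fun i => secOff z (W i)) (fun i => isUpperSet_secOff z (hW i))
      (fun i j hij => by rw [← secOff_inter, ← hC_off]; exact secOff_mono z (hcap i j hij))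
    refine le_of_eq_of_le (prod_congr rfl fun i _ => ?_) h
    rw [real_eq_secOn_secOff p v (secOff z (W i))]; ring
  -- T-BERN at `V = 1`
  have key := tbern_holds hpos hbβ hβ1 hs0 hs1 (V := (1 : ℝ)) n u vv m hub hu1 hvβ hv1 hmb hmu hmv hpu hpv hpg k
  refine le_trans (tcoeff_mono univ (fun i _ => measureReal_nonneg) (fun i _ => measureReal_nonneg) (fun i _ => ?_)
    (fun i _ => ?_) k) key
  · -- `μ(W_i | z open) ≤ s + (1−s)·u_i`
    rw [real_eq_secOn_secOff p v (secOn z (W i))]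
    have h1 : (prodBernoulli p).real (secOn v (secOn z (W i))) ≤ 1 := measureReal_le_one
    nlinarith [mul_le_mul_of_nonneg_left h1 hs0]
  · -- `μ(W_i | z closed) = (1−s)·m_i + s·vv_i`
    rw [real_eq_secOn_secOff p v (secOff z (W i))]
    apply le_of_eq; ring

/-- **The coefficientwise pendant theorem from A-safety of `A`** (+ positivity `μ_p(delMinor v A) > 0`). [this work] -/
theorem tcoeff_sections_le_aSafe {v z : ι} (hne : v ≠ z) {A : Set (Set ι)} (hd : DeterminedBy A (↑({z} : Finset ι) : Set ι)ᶜ)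
    (hA : IsUpperSet A) (hsafe : ∀ q, Safe q A) (hpos : 0 < (prodBernoulli p).real (delMinor v A))
    {n : ℕ} (W : Fin n → Set (Set ι)) (hW : ∀ i, IsUpperSet (W i)) (hWA : ∀ i, A ∪ pairOpen v z ⊆ W i)
    (hcap : ∀ i j, i ≠ j → W i ∩ W j ⊆ A ∪ pairOpen v z) (k : ℕ) :
    tcoeff (univ : Finset (Fin n)) (fun i => (prodBernoulli p).real (secOn z (W i)))
        (fun i => (prodBernoulli p).real (secOff z (W i))) k ≤
      tcoeff (univ : Finset (Fin n)) (fullFloorA (p v : ℝ) ((prodBernoulli p).real (delMinor v A)))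
        (fullFloorG (p v : ℝ) ((prodBernoulli p).real (delMinor v A)) ((prodBernoulli p).real (conMinor v A)) 1) k :=
  tcoeff_sections_le p hne hd hA (aSafe_delMinor hA hsafe v p) (aSafe_conMinor hA hsafe v p) (hsafe p) hpos W hW hWA hcap k

end Pendant

end SafeCalc

end Summit.CriticalPhenomena.PercolationContinuityZ3.Theorems.SunflowerPartition
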